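import Summits.CriticalPhenomena.Ising3DConformalLimit.Theses.VolterraWard
import Literature.Probability.LatticeModels.TwistBicrystal
import HarnessLib

/-!
# Crux `VolterraWard.CoreTransparency` (stmt-CriticalPhenomena-11223) — birth skeleton (BC3)

Skeleton-register seat `planner-skel-stmt-CriticalPhenomena-11223-0`, 2026-08-17 (route
`route-CriticalPhenomena-VolterraWard`, rank-3 crux, re-audit bin REPAIRABLE).

The crux (CORE, "zeroth-order transparency of the twist wall"): for every `n`, every compact
`K ⊆ NonCoincident 3 n` of insertion configurations avoiding the wall height `a`, every block size
`w > 0` and `η > 0`: for `ε` small, then `δ` small, then `N` large, uniformly in `x ∈ K`,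
`|C(M) + C(−M) − 2⟨∏σ⟩⁺_{β_c}| ≤ η ⟨∏σ⟩⁺_{β_c}` at the lattice points `[xᵢ/δ]`, where `C(±M)` is the
free-boundary critical Ising correlator on the box `box 3 N` whose bonds are TWISTED across the wall
between the layers `⌊a/δ⌋` and `⌊a/δ⌋ + 1` by the brickwork map `F_{W,±M}` (block `W = ⌊w/δ⌋₊`,
Burgers number `M = ⌊εW⌋`: a square grid, of spacing `w`, of screw dislocations of Burgers LENGTH
`b = εw`). Physically: a low-angle twist grain boundary is invisible at order `ε⁰` as `b → 0` at
fixed spacing (strict irrelevance of the achiral remnant of a fat screw, `Δ_ε > 1`).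

## §1 Bridge (proved here, no `sorry`)

The route (rev 2, cone repair 2026-08-15) inlines `C` as `isingExpect (SimpleGraph.fromRel <bond
predicate>) univ β_c 0 free (∏ᵢ σ_{yᵢ} or 0)` on `↥(box 3 N)`, whereas the tree names the same
average `twistCorr N W M A n y` (`Literature/Probability/LatticeModels/TwistCorr.lean`, the
`PairIsing.avg` spelling of rev 1). We prove the bridge the cone repair left as evidence only
(`Bridge.lean` on the item): `routeC = twistCorr` (`routeC_eq_twistCorr`: free zero-field Ising on
`fromRel r` with `Λ = univ` is the pair-interaction average with couplings `β/2·𝟙{adjacent}`, by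
`PairIsing.avg_adj_eq_isingExpect_free` + `PairIsing.avg_comp_equiv` along `V ≃ ↥univ`, and
`fromRel` of the bond predicate is `twistAdj`, which is already symmetric and irreflexive), after the
SYNTACTIC restatement `coreTransparency_iff_routeC` (`Iff.rfl`). Hence `coreTransparency_iff`: the
crux, verbatim, over `twistCorr`.

## §2 The line: CORE = (transparency of the twist wall IN THE BICRYSTAL FRAME) + (asymptotic
ratio-equicontinuity of the bulk critical correlators)

Two registered stubs, the only `sorry`s of this file, different in kind:

* `stub_bicrystalTransparency` (DEFECT content, one-signed, both chiralities). The twisted box is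
  the RELABELLING by `Φ = wallRelabel W M A` (identity below the wall, `F` above; tree
  `TwistBicrystal.lean`, `twistCorr_eq_isingExpect_bicrystal`) of the BICRYSTAL: two perfect
  half-crystals re-glued across the wall plane by the discretised rotation `F`. The stub: in the same
  limit order as the crux and under the same hypotheses, for each Burgers number `M = ±⌊εW⌋`,
  `|twistCorr N W M A n [x/δ] − ⟨∏ᵢ σ_{Φ[xᵢ/δ]}⟩⁺_{β_c}| ≤ η ⟨∏ᵢ σ_{Φ[xᵢ/δ]}⟩⁺_{β_c}`: the twisted
  correlator is the BULK critical correlator at the insertions' positions in their own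
  half-crystal's frame, up to a relative `o(1)` as `b = εw → 0` — "a low-angle twist boundary between
  two perfect crystals is transparent at zeroth order". It contains the `N → ∞` limit on twisted
  graphs (GKS monotone along boxes, routine), the identification free = plus state at `β_c(3)` (in
  tree for the plain lattice: `criticalCorr_wellDefined_holds`, Aizenman–Duminil-Copin–Sidoravicius
  2015) and the open defect estimate proper (fat-screw cores of radius `b` on a grid of spacing `w`;
  why it might fail: a `ℤ₂`-breaking core would make every screw a relevant pinning line, see the
  refuter's `CoreTransparency-attack.md` on the item). Size: open-problem.
* `stub_criticalRatioEquicontinuity` (BULK regularity, no defect at all). For every compact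
  `K ⊆ NonCoincident 3 n` and `η > 0` there are `τ > 0` and `δ₀ > 0` such that for `δ < δ₀`,
  uniformly in `x ∈ K`, moving the CONTINUUM insertion points by at most `τ` each changes the lattice
  critical correlator `⟨∏ᵢ σ_{[xᵢ/δ]}⟩⁺_{β_c}` by a relative error `≤ η`. This is the "hidden input"
  the crux-attack refuter isolated (upper insertions are `F`-displaced by `O(ε·diam K)`
  macroscopically); it follows from the route's own items (C) `ExistsScaleCovariantLimit` (locally
  uniform limit) + `LimitContinuous` + GKS positivity of `S` off the diagonals, and is strictly weaker
  than them (no limit, no covariance: asymptotic equicontinuity of ratios only); unconditionally it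
  contains two-point ratio regularity / doubling at `β_c(3)`, which is open. Size: L.

## §3 The composition `CoreTransparency_of` (kernel-checked, no `sorry`)

Given `η`, take `τ, δ₂` from the second stub at `η₂ = min (η/4) 1` and `ε₁` from the first at
`η₁ = η/8`; a coordinate bound `R` for the compact `K`; `ε₀ = min ε₁ (min 1 (τ/(3R+3w+1)))`. For
`M = ±⌊εW⌋` one has `|M| ≤ εW`, and the EXACT INTERTWINING `F_{W,M}[v/δ] = [F^cont_{W,M,δ} v/δ]`
(tree `brickworkMap_latticeApprox`) writes `Φ[xᵢ/δ] = [x'ᵢ/δ]` with `x'ᵢ = xᵢ` below the wall and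
`x'ᵢ = F^cont(xᵢ)` above, where `‖F^cont v − v‖ ≤ ε(|v₀| + 2|v₁| + 3w) ≤ τ`
(`norm_brickworkMapCont_sub_le`: block indices `k = ⌊v₁/(Wδ)⌋`, `j = ⌊(v₀ − Mδk)/(Wδ)⌋`,
`|M|δ|k| ≤ ε(|v₁| + w)`, `|M|δ|j| ≤ ε(|v₀| + |v₁| + 2w)`). Then
`|C(M) + C(−M) − 2c| ≤ |C(M) − c₊| + |C(−M) − c₋| + |c₊ − c| + |c₋ − c| ≤ (η/8)(c₊ + c₋) + 2η₂ c ≤ ηc`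
with `c± = ⟨∏σ_{[x'±/δ]}⟩ ≤ (1 + η₂)c ≤ 2c`. `CoreTransparency_of_stubs` feeds the two registered stubs.

Neither stub is the crux or the summit: the first is one-signed and lives in the bicrystal frame
(for insertions above the wall outside the central brick column `Φ ≠ id` as soon as `M ≥ 1`), the
second mentions no twisted graph; BC3 probes (stub → crux, stub → `Ising3DConformalLimit`,
stub → `¬ Ising3DConformalLimit` by `first | exact? | simpa | aesop`) all fail, see `BC3-probes.md`.
Disproof used: none exists for this crux (`ledger crux ls stmt-CriticalPhenomena-11223`: no workfiles
before this one); the item's refuter evidence (`OddSector.lean`: odd `n` forces `m*(β_c(3)) = 0`, in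
tree; `CoreTransparency-attack.md`: `ha` is load-bearing — both stubs keep the crux's hypotheses
verbatim, and the first keeps `∀ x ∈ K, ∀ i, x i 2 ≠ a`). Negatives index: no Ising3D entry concerns
twisted graphs or equicontinuity.

References: W. Cai, W. D. Nix, Imperfections in Crystalline Solids (CUP 2016) §14.2.2, eq. (14.25)
(twist boundary = two perpendicular screw arrays, `θ ≈ b/s`); H. Duminil-Copin, ICM 2022 §8.1, §8.4
(critical `ℤ³` correlators, scaling limit open); M. Aizenman, H. Duminil-Copin, V. Sidoravicius,
CMP 334 (2015) Thm 1.2 (`m*(β_c) = 0`, free = plus at `β_c`); S. Friedli, Y. Velenik (CUP 2017)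
§3.1 eq. (3.8) (free b.c. on a finite graph); F. Iglói, I. Peschel, L. Turban, Adv. Phys. 42 (1993)
683, doi:10.1080/00018739300101544 §§2–3 (relevance of line defects).
-/

noncomputable section

namespace Summit.CriticalPhenomena.Ising3DConformalLimit.Cruxes.CoreTransparency.Birth

open scoped BigOperators Topology Manifold Classical MeasureTheory ProbabilityTheory Matrix InnerProductSpace ComplexConjugate ContinuousMap
open Filter Set Function TopologicalSpace MeasureTheory
open Literature.Probability.LatticeModels

/-! ## §1 Bridge: the route's inline twisted correlator is `twistCorr` -/

/-- The route's twisted free-box correlator in its rev-2 (`isingExpect ∘ SimpleGraph.fromRel`)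
spelling, verbatim the `let C` of `Theses.VolterraWard.CoreTransparency` with `F := brickworkMap`
(definitionally the route's `let F`, `brickworkMap_eq`). [folklore] -/
def routeC (N W : ℕ) (M A : ℤ) (n : ℕ) (y : Fin n → Site 3) : ℝ :=
  isingExpect (SimpleGraph.fromRel fun a b : ↥(box 3 N) =>
      (a.1 2 = b.1 2 ∧ a.1 2 ≤ A ∧ |a.1 0 - b.1 0| + |a.1 1 - b.1 1| = 1) ∨
      (a.1 2 = b.1 2 ∧ A < a.1 2 ∧
        |brickworkMap W M a.1 0 - brickworkMap W M b.1 0| +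
          |brickworkMap W M a.1 1 - brickworkMap W M b.1 1| = 1) ∨
      (a.1 0 = b.1 0 ∧ a.1 1 = b.1 1 ∧ |a.1 2 - b.1 2| = 1))
    Finset.univ (criticalBeta 3) 0 BoundaryCondition.free
    (fun s => ∏ i, if h : y i ∈ box 3 N then spinAt (⟨y i, h⟩ : ↥(box 3 N)) s else 0)

/-- Syntactic restatement of the crux over `routeC` (pure `Iff.rfl`: zeta/beta/delta). [folklore] -/
theorem coreTransparency_iff_routeC :
    Theses.VolterraWard.CoreTransparency ↔
      ∀ (n : ℕ) (K : Set (Fin n → EuclideanSpace ℝ (Fin 3))), K ⊆ NonCoincident 3 n → IsCompact K →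
        ∀ (a w η : ℝ), (∀ x ∈ K, ∀ i, x i 2 ≠ a) → 0 < w → 0 < η →
          ∃ ε₀ > (0 : ℝ), ∀ ε ∈ Set.Ioo 0 ε₀, ∃ δ₀ > (0 : ℝ), ∀ δ ∈ Set.Ioo 0 δ₀, ∃ N₀ : ℕ, ∀ N ≥ N₀,
            ∀ x ∈ K,
              |routeC N ⌊w / δ⌋₊ ⌊ε * ⌊w / δ⌋₊⌋ ⌊a / δ⌋ n (fun i => latticeApprox δ (x i)) +
                    routeC N ⌊w / δ⌋₊ (-⌊ε * ⌊w / δ⌋₊⌋) ⌊a / δ⌋ n (fun i => latticeApprox δ (x i)) -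
                  2 * criticalCorr 3 n (fun i => latticeApprox δ (x i))| ≤
                η * criticalCorr 3 n (fun i => latticeApprox δ (x i)) :=
  Iff.rfl

/-- **Free zero-field Ising on `SimpleGraph.fromRel r` with `Λ = univ` is the pair-interaction
average with couplings `β/2 · 𝟙{adjacent}`** (the instance arguments of the left side are plain
implicits, so that the lemma rewrites the route's own elaborated term). [cite: FriedliVelenik2017, §3.1, eq. (3.8)] -/
theorem isingExpect_fromRel_univ_free_eq_avg {V : Type*} [Fintype V] {instDE : DecidableEq V}
    (r : V → V → Prop) [DecidableRel r] {instLF : (SimpleGraph.fromRel r).LocallyFinite}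
    (β : ℝ) (f : SpinConfig V → ℝ) :
    @isingExpect V (SimpleGraph.fromRel r) instDE instLF Finset.univ β 0 BoundaryCondition.free f =
      PairIsing.avg (fun a b => if (SimpleGraph.fromRel r).Adj a b then β / 2 else 0) f := by
  set e : V ≃ ↥(Finset.univ : Finset V) := (Equiv.subtypeUnivEquiv Finset.mem_univ).symm with he
  set c : ↥(Finset.univ : Finset V) → ↥(Finset.univ : Finset V) → ℝ :=
    fun a b => if (SimpleGraph.fromRel r).Adj a b then β / 2 else 0 with hc
  set f' : SpinConfig ↥(Finset.univ : Finset V) → ℝ :=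
    fun s' => f (fun v => s' ⟨v, Finset.mem_univ v⟩) with hf'
  have key := PairIsing.avg_comp_equiv e c f'
  have key2 := PairIsing.avg_adj_eq_isingExpect_free (SimpleGraph.fromRel r)
    (Finset.univ : Finset V) β f'
  calc isingExpect (SimpleGraph.fromRel r) Finset.univ β 0 BoundaryCondition.free f
      = isingExpect (SimpleGraph.fromRel r) Finset.univ β 0 BoundaryCondition.free
          (fun σ => f' (fun a => σ a)) := rfl
    _ = PairIsing.avg c f' := key2.symm
    _ = PairIsing.avg (fun a b => c (e a) (e b)) (fun s => f' (s ∘ e.symm)) := key.symm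
    _ = PairIsing.avg (fun a b => if (SimpleGraph.fromRel r).Adj a b then β / 2 else 0) f := rfl

/-- The symmetrised, irreflexive closure (`SimpleGraph.fromRel`) of the inlined bond predicate is
the twisted bond relation `twistAdj` (which is already symmetric and irreflexive). [folklore] -/
theorem fromRel_twist_adj_iff (N W : ℕ) (M A : ℤ) (a b : ↥(box 3 N)) :
    (SimpleGraph.fromRel fun a b : ↥(box 3 N) =>
      (a.1 2 = b.1 2 ∧ a.1 2 ≤ A ∧ |a.1 0 - b.1 0| + |a.1 1 - b.1 1| = 1) ∨
      (a.1 2 = b.1 2 ∧ A < a.1 2 ∧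
        |brickworkMap W M a.1 0 - brickworkMap W M b.1 0| +
          |brickworkMap W M a.1 1 - brickworkMap W M b.1 1| = 1) ∨
      (a.1 0 = b.1 0 ∧ a.1 1 = b.1 1 ∧ |a.1 2 - b.1 2| = 1)).Adj a b ↔ twistAdj W M A a.1 b.1 := by
  rw [SimpleGraph.fromRel_adj]
  change a ≠ b ∧ (twistAdj W M A a.1 b.1 ∨ twistAdj W M A b.1 a.1) ↔ _
  constructor
  · rintro ⟨-, h | h⟩
    · exact h
    · exact twistAdj_symm h
  · intro h
    refine ⟨?_, Or.inl h⟩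
    rintro rfl
    exact twistAdj_irrefl W M A _ h

/-- **Bridge** (propositional): the rev-2 inline correlator IS the named `twistCorr` of
`Literature/Probability/LatticeModels/TwistCorr.lean` (free Ising on `fromRel` of the bond predicate
= pair-interaction average with couplings `β_c/2 · 𝟙{twistAdj}`). [folklore] -/
theorem routeC_eq_twistCorr : routeC = twistCorr := by
  funext N W M A n y
  unfold routeC
  rw [isingExpect_fromRel_univ_free_eq_avg]
  unfold twistCorr
  congr 1
  funext a b
  rw [twistCouplings_eq_ite]
  by_cases h : twistAdj W M A a.1 b.1
  · rw [if_pos h, if_pos ((fromRel_twist_adj_iff N W M A a b).2 h)]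
  · rw [if_neg h, if_neg (mt (fromRel_twist_adj_iff N W M A a b).1 h)]

/-- **The crux over the named twisted correlator** (verbatim, `C ↦ twistCorr`). [folklore] -/
theorem coreTransparency_iff :
    Theses.VolterraWard.CoreTransparency ↔
      ∀ (n : ℕ) (K : Set (Fin n → EuclideanSpace ℝ (Fin 3))), K ⊆ NonCoincident 3 n → IsCompact K →
        ∀ (a w η : ℝ), (∀ x ∈ K, ∀ i, x i 2 ≠ a) → 0 < w → 0 < η →
          ∃ ε₀ > (0 : ℝ), ∀ ε ∈ Set.Ioo 0 ε₀, ∃ δ₀ > (0 : ℝ), ∀ δ ∈ Set.Ioo 0 δ₀, ∃ N₀ : ℕ, ∀ N ≥ N₀,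
            ∀ x ∈ K,
              |twistCorr N ⌊w / δ⌋₊ ⌊ε * ⌊w / δ⌋₊⌋ ⌊a / δ⌋ n (fun i => latticeApprox δ (x i)) +
                    twistCorr N ⌊w / δ⌋₊ (-⌊ε * ⌊w / δ⌋₊⌋) ⌊a / δ⌋ n (fun i => latticeApprox δ (x i)) -
                  2 * criticalCorr 3 n (fun i => latticeApprox δ (x i))| ≤
                η * criticalCorr 3 n (fun i => latticeApprox δ (x i)) := by
  rw [coreTransparency_iff_routeC, routeC_eq_twistCorr]

/-! ## §2 The stub statements as named propositions (verbatim copies of the stub signatures) -/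

namespace Sig

/-- Statement of `stub_bicrystalTransparency` (transparency of the twist wall in the bicrystal frame,
one Burgers sign at a time). -/
def stub_bicrystalTransparency : Prop :=
    ∀ (n : ℕ) (K : Set (Fin n → EuclideanSpace ℝ (Fin 3))), K ⊆ NonCoincident 3 n → IsCompact K →
      ∀ (a w η : ℝ), (∀ x ∈ K, ∀ i, x i 2 ≠ a) → 0 < w → 0 < η →
        ∃ ε₀ > (0 : ℝ), ∀ ε ∈ Set.Ioo 0 ε₀, ∃ δ₀ > (0 : ℝ), ∀ δ ∈ Set.Ioo 0 δ₀, ∃ N₀ : ℕ, ∀ N ≥ N₀,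
          ∀ x ∈ K, ∀ M : ℤ, |M| = ⌊ε * ⌊w / δ⌋₊⌋ →
            |twistCorr N ⌊w / δ⌋₊ M ⌊a / δ⌋ n (fun i => latticeApprox δ (x i)) -
                criticalCorr 3 n (fun i => wallRelabel ⌊w / δ⌋₊ M ⌊a / δ⌋ (latticeApprox δ (x i)))| ≤
              η * criticalCorr 3 n (fun i => wallRelabel ⌊w / δ⌋₊ M ⌊a / δ⌋ (latticeApprox δ (x i)))

/-- Statement of `stub_criticalRatioEquicontinuity` (asymptotic ratio-equicontinuity of the critical
correlators at macroscopic scale). -/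
def stub_criticalRatioEquicontinuity : Prop :=
    ∀ (n : ℕ) (K : Set (Fin n → EuclideanSpace ℝ (Fin 3))), K ⊆ NonCoincident 3 n → IsCompact K →
      ∀ η : ℝ, 0 < η → ∃ τ > (0 : ℝ), ∃ δ₀ > (0 : ℝ), ∀ δ ∈ Set.Ioo 0 δ₀, ∀ x ∈ K,
        ∀ x' : Fin n → EuclideanSpace ℝ (Fin 3), (∀ i, ‖x' i - x i‖ ≤ τ) →
          |criticalCorr 3 n (fun i => latticeApprox δ (x' i)) -
              criticalCorr 3 n (fun i => latticeApprox δ (x i))| ≤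
            η * criticalCorr 3 n (fun i => latticeApprox δ (x i))

end Sig

/-! ## §3 The registered stubs (the only `sorry`s of this file) -/

/-- **stub_bicrystalTransparency** (TRANSPARENCY OF THE TWIST WALL IN THE BICRYSTAL FRAME). In the
crux's limit order (`ε → 0`, then `δ → 0`, then `N → ∞`, uniformly on a compact `K` of
non-coincident configurations avoiding the wall height `a`; block `W = ⌊w/δ⌋₊`, wall between layers
`⌊a/δ⌋`, `⌊a/δ⌋ + 1`), for each Burgers number `M = ±⌊εW⌋`: the critical free-box correlator on the
twisted box equals the bulk critical correlator `⟨∏ᵢ σ_{Φ(yᵢ)}⟩⁺_{β_c}` at the wall-relabelled sites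
`Φ = wallRelabel W M ⌊a/δ⌋` (identity below the wall, brickwork map `F_{W,M}` above: the positions of
the insertions in their own half-crystal's frame, `twistCorr_eq_isingExpect_bicrystal`), up to a
relative error `η`. The defect content of the crux: a grid (spacing `w`) of screw dislocations of
Burgers length `εw → 0` is invisible at zeroth order; contains GKS box monotonicity on twisted graphs
and free = plus at `β_c(3)`; open (strict irrelevance of even line defects, `Δ_ε > 1`).
[cite: CaiNix2016, §14.2.2 eq. (14.25)] [cite: AizenmanDuminilCopinSidoraviciusCMP2015, Thm. 1.2] -/
theorem stub_bicrystalTransparency :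
    ∀ (n : ℕ) (K : Set (Fin n → EuclideanSpace ℝ (Fin 3))), K ⊆ NonCoincident 3 n → IsCompact K →
      ∀ (a w η : ℝ), (∀ x ∈ K, ∀ i, x i 2 ≠ a) → 0 < w → 0 < η →
        ∃ ε₀ > (0 : ℝ), ∀ ε ∈ Set.Ioo 0 ε₀, ∃ δ₀ > (0 : ℝ), ∀ δ ∈ Set.Ioo 0 δ₀, ∃ N₀ : ℕ, ∀ N ≥ N₀,
          ∀ x ∈ K, ∀ M : ℤ, |M| = ⌊ε * ⌊w / δ⌋₊⌋ →
            |twistCorr N ⌊w / δ⌋₊ M ⌊a / δ⌋ n (fun i => latticeApprox δ (x i)) -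
                criticalCorr 3 n (fun i => wallRelabel ⌊w / δ⌋₊ M ⌊a / δ⌋ (latticeApprox δ (x i)))| ≤
              η * criticalCorr 3 n
                (fun i => wallRelabel ⌊w / δ⌋₊ M ⌊a / δ⌋ (latticeApprox δ (x i))) := by
  sorry

/-- **stub_criticalRatioEquicontinuity** (ASYMPTOTIC RATIO-EQUICONTINUITY OF THE CRITICAL
CORRELATORS). For every compact `K` of non-coincident configurations and `η > 0` there are `τ > 0`
and `δ₀ > 0` such that for every mesh `δ < δ₀`, uniformly in `x ∈ K`, every configuration `x'`
with `‖x'ᵢ − xᵢ‖ ≤ τ` for all `i` has `|⟨∏σ_{[x'ᵢ/δ]}⟩⁺_{β_c} − ⟨∏σ_{[xᵢ/δ]}⟩⁺_{β_c}| ≤ η ⟨∏σ_{[xᵢ/δ]}⟩⁺_{β_c}`.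
The bulk-regularity input of the crux (no defect): implied by a locally uniform, continuous,
positive scaling limit (route items `ExistsScaleCovariantLimit` + `LimitContinuous` + GKS), strictly
weaker; contains two-point ratio regularity at `β_c(3)`, open. Odd `n`: both sides vanish
(`criticalCorr_eq_zero_of_odd`). [cite: DuminilCopinICM2022, §8.1 eq. (8.1) and §8.4 p. 29] -/
theorem stub_criticalRatioEquicontinuity :
    ∀ (n : ℕ) (K : Set (Fin n → EuclideanSpace ℝ (Fin 3))), K ⊆ NonCoincident 3 n → IsCompact K →
      ∀ η : ℝ, 0 < η → ∃ τ > (0 : ℝ), ∃ δ₀ > (0 : ℝ), ∀ δ ∈ Set.Ioo 0 δ₀, ∀ x ∈ K,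
        ∀ x' : Fin n → EuclideanSpace ℝ (Fin 3), (∀ i, ‖x' i - x i‖ ≤ τ) →
          |criticalCorr 3 n (fun i => latticeApprox δ (x' i)) -
              criticalCorr 3 n (fun i => latticeApprox δ (x i))| ≤
            η * criticalCorr 3 n (fun i => latticeApprox δ (x i)) := by
  sorry

/-! ## §4 Glue lemmas (all proved): intertwining, displacement of the brickwork map, compactness -/

/-- **Wall relabelling of a lattice approximation is a lattice approximation**: below the wall
nothing moves, above it the exact intertwining `F_{W,M}[v/δ] = [F^cont_{W,M,δ} v/δ]`
(`brickworkMap_latticeApprox`). [folklore] -/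
theorem wallRelabel_latticeApprox {δ : ℝ} (hδ : 0 < δ) (W : ℕ) (M A : ℤ)
    (v : EuclideanSpace ℝ (Fin 3)) :
    wallRelabel W M A (latticeApprox δ v) =
      latticeApprox δ (if ⌊v 2 / δ⌋ ≤ A then v else brickworkMapCont W M δ v) := by
  by_cases h : ⌊v 2 / δ⌋ ≤ A
  · rw [if_pos h, wallRelabel_of_le W M A (show latticeApprox δ v 2 ≤ A from h)]
  · rw [if_neg h, wallRelabel_of_lt W M A (show A < latticeApprox δ v 2 from lt_of_not_ge h),
      brickworkMap_latticeApprox hδ]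

/-- `‖z‖ ≤ |z₀| + |z₁| + |z₂|` in `ℝ³` (Euclidean norm versus `ℓ¹`). [folklore] -/
theorem norm_le_abs_add_three (z : EuclideanSpace ℝ (Fin 3)) : ‖z‖ ≤ |z 0| + |z 1| + |z 2| := by
  rw [EuclideanSpace.norm_eq, Fin.sum_univ_three]
  simp only [Real.norm_eq_abs]
  have h0 := abs_nonneg (z 0)
  have h1 := abs_nonneg (z 1)
  have h2 := abs_nonneg (z 2)
  calc Real.sqrt (|z 0| ^ 2 + |z 1| ^ 2 + |z 2| ^ 2)
      ≤ Real.sqrt ((|z 0| + |z 1| + |z 2|) ^ 2) := Real.sqrt_le_sqrt (by nlinarith)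
    _ = |z 0| + |z 1| + |z 2| := Real.sqrt_sq (by positivity)

/-- `|⌊r⌋| ≤ |r| + 1`. [folklore] -/
theorem abs_floor_le (r : ℝ) : |((⌊r⌋ : ℤ) : ℝ)| ≤ |r| + 1 := by
  have h1 := Int.floor_le r
  have h2 := Int.lt_floor_add_one r
  have h3 := neg_abs_le r
  have h4 := le_abs_self r
  rw [abs_le]
  constructor <;> linarith

/-- `|⌊t/L⌋|·L ≤ |t| + L` for `L > 0` (a block index times the block size). [folklore] -/
theorem abs_floor_div_mul_le {L : ℝ} (hL : 0 < L) (t : ℝ) :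
    |((⌊t / L⌋ : ℤ) : ℝ)| * L ≤ |t| + L := by
  have h := abs_floor_le (t / L)
  rw [abs_div, abs_of_pos hL] at h
  calc |((⌊t / L⌋ : ℤ) : ℝ)| * L ≤ (|t| / L + 1) * L := mul_le_mul_of_nonneg_right h hL.le
    _ = |t| + L := by field_simp

/-- **Displacement of the continuum brickwork map**: if `|M| ≤ εW`, `0 ≤ ε ≤ 1` and `Wδ ≤ w`, then
`‖F^cont_{W,M,δ}(v) − v‖ ≤ ε (|v₀| + 2|v₁| + 3w)` — the discretised rotation by `ε` moves a point at
distance `r` from the axis by `O(ε r)` plus `O(εw)` brick offsets. Block indices `k = ⌊v₁/(Wδ)⌋`,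
`j = ⌊(v₀ − Mδk)/(Wδ)⌋`; `|M|δ|k| ≤ ε(|v₁| + w)`, `|M|δ|j| ≤ ε(|v₀| + |v₁| + 2w)`. [folklore] -/
theorem norm_brickworkMapCont_sub_le {δ ε w : ℝ} (hδ : 0 < δ) (hε : 0 ≤ ε) (hε1 : ε ≤ 1)
    {W : ℕ} (hW : (W : ℝ) * δ ≤ w) {M : ℤ} (hM : |(M : ℝ)| ≤ ε * W)
    (v : EuclideanSpace ℝ (Fin 3)) :
    ‖brickworkMapCont W M δ v - v‖ ≤ ε * (|v 0| + 2 * |v 1| + 3 * w) := by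
  have hw0 : 0 ≤ w := le_trans (by positivity) hW
  rcases Nat.eq_zero_or_pos W with hW0 | hWpos
  · -- no block: `W = 0` forces `M = 0`, and `F^cont_{W,0,δ} = id`
    subst hW0
    have hM0 : M = 0 := by
      have h0 : |(M : ℝ)| ≤ 0 := by simpa using hM
      exact_mod_cast abs_nonpos_iff.1 h0
    subst hM0
    rw [brickworkMapCont_zero, sub_self, norm_zero]
    positivity
  · have hL : 0 < (W : ℝ) * δ := by positivity
    have hdisp : brickworkMapCont W M δ v - v =
        ((M : ℝ) * δ) • WithLp.toLp 2 ![-(⌊v 1 / ((W : ℝ) * δ)⌋ : ℝ),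
          (⌊(v 0 - (M : ℝ) * δ * (⌊v 1 / ((W : ℝ) * δ)⌋ : ℝ)) / ((W : ℝ) * δ)⌋ : ℝ), 0] := by
      unfold brickworkMapCont
      exact add_sub_cancel_left _ _
    rw [hdisp]
    set L : ℝ := (W : ℝ) * δ with hLdef
    set k : ℤ := ⌊v 1 / L⌋ with hk
    set j : ℤ := ⌊(v 0 - (M : ℝ) * δ * (k : ℝ)) / L⌋ with hj
    have hu : ‖WithLp.toLp 2 ![-(k : ℝ), (j : ℝ), 0]‖ ≤ |(k : ℝ)| + |(j : ℝ)| := by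
      refine (norm_le_abs_add_three _).trans (le_of_eq ?_)
      simp
    have hMδ : |(M : ℝ)| * δ ≤ ε * L := by
      rw [hLdef]
      nlinarith [hM, hδ.le]
    have hk' : |(k : ℝ)| * L ≤ |v 1| + L := abs_floor_div_mul_le hL (v 1)
    have hj' : |(j : ℝ)| * L ≤ |v 0 - (M : ℝ) * δ * (k : ℝ)| + L := abs_floor_div_mul_le hL _
    have h1 : |(M : ℝ)| * δ * |(k : ℝ)| ≤ ε * (|v 1| + L) :=
      calc |(M : ℝ)| * δ * |(k : ℝ)| ≤ ε * L * |(k : ℝ)| :=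
            mul_le_mul_of_nonneg_right hMδ (abs_nonneg _)
        _ = ε * (|(k : ℝ)| * L) := by ring
        _ ≤ ε * (|v 1| + L) := mul_le_mul_of_nonneg_left hk' hε
    have h2 : |v 0 - (M : ℝ) * δ * (k : ℝ)| ≤ |v 0| + ε * (|v 1| + L) := by
      refine (abs_sub _ _).trans ?_
      rw [abs_mul, abs_mul, abs_of_pos hδ]
      linarith [h1]
    have h3 : |(M : ℝ)| * δ * |(j : ℝ)| ≤ ε * (|v 0| + ε * (|v 1| + L) + L) :=
      calc |(M : ℝ)| * δ * |(j : ℝ)| ≤ ε * L * |(j : ℝ)| :=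
            mul_le_mul_of_nonneg_right hMδ (abs_nonneg _)
        _ = ε * (|(j : ℝ)| * L) := by ring
        _ ≤ ε * (|v 0 - (M : ℝ) * δ * (k : ℝ)| + L) := mul_le_mul_of_nonneg_left hj' hε
        _ ≤ ε * (|v 0| + ε * (|v 1| + L) + L) :=
            mul_le_mul_of_nonneg_left (add_le_add h2 le_rfl) hε
    have hL_le_w : L ≤ w := hW
    calc ‖((M : ℝ) * δ) • WithLp.toLp 2 ![-(k : ℝ), (j : ℝ), 0]‖
        = |(M : ℝ)| * δ * ‖WithLp.toLp 2 ![-(k : ℝ), (j : ℝ), 0]‖ := by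
          rw [norm_smul, Real.norm_eq_abs, abs_mul, abs_of_pos hδ]
      _ ≤ |(M : ℝ)| * δ * (|(k : ℝ)| + |(j : ℝ)|) :=
          mul_le_mul_of_nonneg_left hu (by positivity)
      _ = |(M : ℝ)| * δ * |(k : ℝ)| + |(M : ℝ)| * δ * |(j : ℝ)| := by ring
      _ ≤ ε * (|v 1| + L) + ε * (|v 0| + ε * (|v 1| + L) + L) := add_le_add h1 h3
      _ ≤ ε * (|v 0| + 2 * |v 1| + 3 * w) := by
          nlinarith [mul_nonneg (mul_nonneg hε (sub_nonneg.2 hε1)) (abs_nonneg (v 1)),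
            mul_nonneg (mul_nonneg hε (sub_nonneg.2 hε1)) hL.le,
            mul_nonneg hε (sub_nonneg.2 hL_le_w), abs_nonneg (v 0), abs_nonneg (v 1)]

/-- A compact set of configurations has uniformly bounded coordinates. [folklore] -/
theorem exists_coord_bound {n : ℕ} {K : Set (Fin n → EuclideanSpace ℝ (Fin 3))} (hK : IsCompact K) :
    ∃ R : ℝ, 0 ≤ R ∧ ∀ x ∈ K, ∀ (i : Fin n) (j : Fin 3), |x i j| ≤ R := by
  obtain ⟨C, hC⟩ := hK.isBounded.exists_norm_le
  refine ⟨max C 0, le_max_right _ _, fun x hx i j => ?_⟩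
  calc |x i j| = ‖x i j‖ := (Real.norm_eq_abs _).symm
    _ ≤ ‖x i‖ := PiLp.norm_apply_le (x i) j
    _ ≤ ‖x‖ := norm_le_pi_norm x i
    _ ≤ C := hC x hx
    _ ≤ max C 0 := le_max_left _ _

/-- **The wall relabelling moves the continuum insertion points by at most `τ`** once
`ε (3R + 3w + 1) ≤ τ`: for a block `W` with `Wδ ≤ w`, `|M| ≤ εW` and any wall height `A`, every
configuration `x` with coordinates bounded by `R` has `Φ[xᵢ/δ] = [x'ᵢ/δ]` for some `x'` with
`‖x'ᵢ − xᵢ‖ ≤ τ`. [folklore] -/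
theorem exists_relabel_config {n : ℕ} {δ ε w τ R : ℝ} (hδ : 0 < δ) (hε : 0 ≤ ε) (hε1 : ε ≤ 1)
    (hw : 0 ≤ w) (hR : 0 ≤ R) (hετ : ε * (3 * R + 3 * w + 1) ≤ τ)
    {W : ℕ} (hW : (W : ℝ) * δ ≤ w) {M : ℤ} (hM : |(M : ℝ)| ≤ ε * W) (A : ℤ)
    (x : Fin n → EuclideanSpace ℝ (Fin 3)) (hx : ∀ (i : Fin n) (j : Fin 3), |x i j| ≤ R) :
    ∃ x' : Fin n → EuclideanSpace ℝ (Fin 3),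
      (fun i => wallRelabel W M A (latticeApprox δ (x i))) = (fun i => latticeApprox δ (x' i)) ∧
        ∀ i, ‖x' i - x i‖ ≤ τ := by
  refine ⟨fun i => if ⌊x i 2 / δ⌋ ≤ A then x i else brickworkMapCont W M δ (x i),
    funext fun i => wallRelabel_latticeApprox hδ W M A (x i), fun i => ?_⟩
  show ‖(if ⌊x i 2 / δ⌋ ≤ A then x i else brickworkMapCont W M δ (x i)) - x i‖ ≤ τ
  have hτ0 : 0 ≤ τ := le_trans (by positivity) hετ
  split_ifs with h
  · simpa using hτ0
  · refine (norm_brickworkMapCont_sub_le hδ hε hε1 hW hM (x i)).trans ?_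
    have h0 := hx i 0
    have h1 := hx i 1
    nlinarith [abs_nonneg (x i 0), abs_nonneg (x i 1)]

/-! ## §5 The composition (no `sorry`) -/

/-- **The line closes the crux.** Bicrystal-frame transparency at `±⌊εW⌋` (stub 1, error `η/8`
relative to the relabelled bulk correlators) plus ratio-equicontinuity of the bulk correlators under
the `O(ε (diam K + w))` relabelling displacement (stub 2, error `min (η/4) 1`), combined through the
exact intertwining `Φ[x/δ] = [x'/δ]` and the triangle inequality. Hypotheses = the two stub
statements BY NAME (`Sig.stub_*`). [folklore] -/
theorem CoreTransparency_of :
    Sig.stub_bicrystalTransparency → Sig.stub_criticalRatioEquicontinuity →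
      Summit.CriticalPhenomena.Ising3DConformalLimit.Theses.VolterraWard.CoreTransparency := by
  intro h1 h2
  rw [coreTransparency_iff]
  intro n K hK hKc a w η ha hw hη
  -- (0) coordinates of `K` are bounded
  obtain ⟨R, hR0, hR⟩ := exists_coord_bound hKc
  -- (1) bulk equicontinuity at `η₂ = min (η/4) 1`
  have hη2 : 0 < min (η / 4) 1 := lt_min (by linarith) one_pos
  obtain ⟨τ, hτ, δ₂, hδ₂, H2⟩ := h2 n K hK hKc (min (η / 4) 1) hη2
  -- (2) bicrystal transparency at `η₁ = η/8`
  obtain ⟨ε₁, hε₁, H1⟩ := h1 n K hK hKc a w (η / 8) ha hw (by linarith)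
  -- (3) the thresholds
  have hden : 0 < 3 * R + 3 * w + 1 := by linarith
  refine ⟨min ε₁ (min 1 (τ / (3 * R + 3 * w + 1))),
    lt_min hε₁ (lt_min one_pos (div_pos hτ hden)), ?_⟩
  rintro ε ⟨hε0, hεlt⟩
  have hεε₁ : ε < ε₁ := lt_of_lt_of_le hεlt (min_le_left _ _)
  have hε1 : ε ≤ 1 := (lt_of_lt_of_le hεlt ((min_le_right _ _).trans (min_le_left _ _))).le
  have hετ : ε * (3 * R + 3 * w + 1) ≤ τ := by
    have h : ε ≤ τ / (3 * R + 3 * w + 1) :=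
      (lt_of_lt_of_le hεlt ((min_le_right _ _).trans (min_le_right _ _))).le
    exact (le_div_iff₀ hden).1 h
  obtain ⟨δ₁, hδ₁, H1'⟩ := H1 ε ⟨hε0, hεε₁⟩
  refine ⟨min δ₁ δ₂, lt_min hδ₁ hδ₂, ?_⟩
  rintro δ ⟨hδ0, hδlt⟩
  have hδδ₁ : δ < δ₁ := lt_of_lt_of_le hδlt (min_le_left _ _)
  have hδδ₂ : δ < δ₂ := lt_of_lt_of_le hδlt (min_le_right _ _)
  obtain ⟨N₀, HN⟩ := H1' δ ⟨hδ0, hδδ₁⟩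
  refine ⟨N₀, fun N hN x hx => ?_⟩
  -- (4) the estimate at `(N, x)`; `W = ⌊w/δ⌋₊`, `Wδ ≤ w`, `Mε = ⌊εW⌋ ≥ 0`, `|±Mε| ≤ εW`
  have hWδ : ((⌊w / δ⌋₊ : ℕ) : ℝ) * δ ≤ w := by
    have h := Nat.floor_le (div_nonneg hw.le hδ0.le)
    calc ((⌊w / δ⌋₊ : ℕ) : ℝ) * δ ≤ w / δ * δ := mul_le_mul_of_nonneg_right h hδ0.le
      _ = w := div_mul_cancel₀ w hδ0.ne'
  set W : ℕ := ⌊w / δ⌋₊ with hWdef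
  set Mε : ℤ := ⌊ε * (W : ℝ)⌋ with hMdef
  have hMnn : 0 ≤ Mε := Int.floor_nonneg.2 (by positivity)
  have hMle : ((Mε : ℤ) : ℝ) ≤ ε * W := Int.floor_le _
  have hMabs : |((Mε : ℤ) : ℝ)| ≤ ε * W := by
    rwa [abs_of_nonneg (by exact_mod_cast hMnn)]
  have hMabs' : |(((-Mε : ℤ)) : ℝ)| ≤ ε * W := by
    rwa [Int.cast_neg, abs_neg]
  -- stub 1 at both chiralities
  have Tp := HN N hN x hx Mε (abs_of_nonneg hMnn)
  have Tm := HN N hN x hx (-Mε) (by rw [abs_neg, abs_of_nonneg hMnn])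
  -- the relabelled configurations are `τ`-close continuum configurations
  obtain ⟨xp, hxp, hdp⟩ :=
    exists_relabel_config hδ0 hε0.le hε1 hw.le hR0 hετ hWδ hMabs ⌊a / δ⌋ x (hR x hx)
  obtain ⟨xm, hxm, hdm⟩ :=
    exists_relabel_config hδ0 hε0.le hε1 hw.le hR0 hετ hWδ hMabs' ⌊a / δ⌋ x (hR x hx)
  rw [hxp] at Tp
  rw [hxm] at Tm
  -- stub 2 at both relabelled configurations
  have Ep := H2 δ ⟨hδ0, hδδ₂⟩ x hx xp hdp
  have Em := H2 δ ⟨hδ0, hδδ₂⟩ x hx xm hdm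
  -- (5) bookkeeping of relative errors
  set c := criticalCorr 3 n (fun i => latticeApprox δ (x i)) with hc
  set cp := criticalCorr 3 n (fun i => latticeApprox δ (xp i)) with hcp
  set cm := criticalCorr 3 n (fun i => latticeApprox δ (xm i)) with hcm
  set tp := twistCorr N W Mε ⌊a / δ⌋ n (fun i => latticeApprox δ (x i)) with htp
  set tm := twistCorr N W (-Mε) ⌊a / δ⌋ n (fun i => latticeApprox δ (x i)) with htm
  have hη2le : min (η / 4) 1 ≤ η / 4 := min_le_left _ _
  have hη2le1 : min (η / 4) 1 ≤ 1 := min_le_right _ _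
  have hc0 : 0 ≤ c := by
    by_contra hneg
    push Not at hneg
    have h := (abs_nonneg _).trans Ep
    nlinarith
  have hEp := abs_le.1 Ep
  have hEm := abs_le.1 Em
  have hTp := abs_le.1 Tp
  have hTm := abs_le.1 Tm
  have hη2c : min (η / 4) 1 * c ≤ η / 4 * c := mul_le_mul_of_nonneg_right hη2le hc0
  have hη2c1 : min (η / 4) 1 * c ≤ 1 * c := mul_le_mul_of_nonneg_right hη2le1 hc0
  have hcp2 : cp ≤ 2 * c := by linarith [hEp.2]
  have hcm2 : cm ≤ 2 * c := by linarith [hEm.2]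
  have h8p : η / 8 * cp ≤ η / 8 * (2 * c) := mul_le_mul_of_nonneg_left hcp2 (by linarith)
  have h8m : η / 8 * cm ≤ η / 8 * (2 * c) := mul_le_mul_of_nonneg_left hcm2 (by linarith)
  rw [abs_le]
  constructor <;> linarith [hEp.1, hEp.2, hEm.1, hEm.2, hTp.1, hTp.2, hTm.1, hTm.2]

/-- **The registered stubs discharge the two hypotheses of `CoreTransparency_of` verbatim** (no
`sorry` of its own; it depends on the stubs' `sorry`s until they land — then it IS the proof of the
crux; it also kernel-checks that each `Sig.stub_X` is definitionally the registered signature of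
`stub_X`). [folklore] -/
theorem CoreTransparency_of_stubs :
    Summit.CriticalPhenomena.Ising3DConformalLimit.Theses.VolterraWard.CoreTransparency :=
  CoreTransparency_of stub_bicrystalTransparency stub_criticalRatioEquicontinuity

end Summit.CriticalPhenomena.Ising3DConformalLimit.Cruxes.CoreTransparency.Birth

end
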